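import Summits.QuantumFields.YangMills.Theorems.ColdStartUniversalityLatticeLangevinHypercontractivity
import Summits.QuantumFields.YangMills.Theorems.ColdStartUniversalityLatticeLangevinWilsonEntropyDecayMeasurable
import Summits.QuantumFields.YangMills.Theorems.ColdStartUniversalityLatticeLangevinWilsonLogSobolev
import Summits.QuantumFields.YangMills.Theorems.ColdStartUniversalityLatticeLangevinBakryEmeryLogSobolev
import HarnessLib

/-!
# Route `ColdStartUniversality` (fixed-cut-off package, `Lᵖ` side): ★★★ HYPERCONTRACTIVITY OF THE SZZ SEMIGROUP, UNCONDITIONALLY —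
# `‖κ_t G‖_{q(t)} ≤ ‖G‖_p` for ALL bounded measurable `G`, with the EXPLICIT exponents `q(t) = 1 + (p−1)e^{4ρt}`,
# `ρ = ½e^{−4|β'|#𝒫}` at every `(L, β')` and `ρ = (1 − 12|β'|)/2` uniformly in `L` for `|β'| < 1/12`

Helper file (seat `ym-line-csu-p1`, g36; `--supports stmt-QuantumFields-24809`), sequel of `…LatticeLangevinHypercontractivity`
(Gross's theorem for positive `C³` cylinders under the generator-form log-Sobolev inequality).  SU(2) lattice Langevin dynamics of
Shen–Zhu–Zhu at `(L, β')`, Wilson measure `μ = μ_{β'}`, ANY realising kernel family `κ` (`κ_t G(x) = E G(U^x_t)`):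

* ★★ `lqNorm_transition_le_of_generatorLogSobolev_of_measurable` — under LSI(`ρ`): for every bounded measurable `G`, `1 < p`, `t ≥ 0`,
  `(∫ |κ_t G|^{q(t)} dμ)^{1/q(t)} ≤ (∫ |G|^p dμ)^{1/p}` (`|κ_tG| ≤ κ_t|G|`; positive cylinders `F_n → |G|` in `L¹(μ)`,
  `exists_pos_cylinder_integral_abs_sub_le`; `∫|κ_tF_n − κ_t|G|| ≤ ∫|F_n − |G||`, `integral_abs_transition_sub_le`; the powers pass to
  the limit by `EntropyFlow.tendsto_integral_comp_of_tendsto_integral_abs_sub`);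
* ★★★ `wilson_hypercontractivity_explicit` — for EVERY `L, β'`: the above with `ρ = ½e^{−4|β'|#𝒫}` (`#𝒫 = card (Plaquette 3 L)`),
  log-Sobolev hypothesis DISCHARGED by `wilson_generatorLogSobolev_explicit` (Holley–Stroock, g22);
* ★★★ `wilson_hypercontractivity_uniform` — for every `L` and `|β'| < 1/12`: the above with `ρ = (1 − 12|β'|)/2`, INDEPENDENT OF `L`
  (`wilson_generatorLogSobolev_uniform`, Bakry–Émery, g26) — the volume-uniform hypercontractivity of SZZ's Cor. 4.4 regime;
* ★★ `wilson_two_to_four` — Nelson's `2 → 4` time: `‖κ_t G‖_{L⁴(μ)} ≤ ‖G‖_{L²(μ)}` at `t = log 3/(4ρ)`, `ρ = ½e^{−4|β'|#𝒫}`.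

THEOREMS ONLY, no definition, no sorry.  HONEST FRAMING: RECORD-rung R3 plumbing at FIXED cut-off: `ρ = ½e^{−4|β'|#𝒫}` degenerates
like `e^{−12|β'|L³}` and carries NO cut-off-uniform information; the volume-uniform window `|β'| < 1/12` is the high-temperature regime,
not the route's scaling `β'_K = (γε_K)⁻¹/2 → ∞`; nothing K-uniform is proved; no crux, rung or summit statement is proved; the Yang–Mills
mass gap is NOT proved.
-/

set_option autoImplicit false

noncomputable section

namespace Summit.QuantumFields.YangMills.Theorems.ColdStartUniversality

open MeasureTheory ProbabilityTheory Filter Set Topology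
open scoped BigOperators NNReal ENNReal
open Literature.Probability.Process Literature.MathematicalPhysics.QuantumFieldTheory
open Literature.MathematicalPhysics.QuantumLattice (fundamentalRep fundamentalLatticeRep continuous_fundamentalRep)

variable {L : ℕ} [NeZero L]

/-! ## §1. All bounded measurable functions -/

/-- ★★ **Gross's theorem on bounded measurable functions.**  Under the generator-form log-Sobolev inequality with constant `ρ ≥ 0`,
for every bounded measurable `G`, every `1 < p`, every realising kernel family and every `t ≥ 0`:
`(∫ |κ_t G|^{q(t)} dμ_{β'})^{1/q(t)} ≤ (∫ |G|^p dμ_{β'})^{1/p}`, `q(t) = 1 + (p−1)e^{4ρt}` — from the positive-cylinder case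
(`lqNorm_transition_le_of_generatorLogSobolev`) by `|κ_tG| ≤ κ_t|G|` and `L¹(μ)` approximation of `|G|` by positive cylinders.
[cite: DiaconisSaloffcoste1996, Theorem 3.5 (ii)] -/
theorem lqNorm_transition_le_of_generatorLogSobolev_of_measurable (L : ℕ) [NeZero L] (β' : ℝ)
    (κ : ℝ≥0 → Kernel (GaugeConfig 3 L (Matrix.specialUnitaryGroup (Fin 2) ℂ))
      (GaugeConfig 3 L (Matrix.specialUnitaryGroup (Fin 2) ℂ))) [∀ t, IsMarkovKernel (κ t)]
    (hreal : ∀ (t : ℝ≥0) (x : GaugeConfig 3 L (Matrix.specialUnitaryGroup (Fin 2) ℂ))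
        (Ω : Type) [MeasurableSpace Ω] (P : Measure Ω) [IsProbabilityMeasure P]
        (W : ℝ≥0 → Ω → (Edge 3 L × NoiseIdx 2 → ℝ)) (hW : IsFlatBrownian W P)
        (U : ℝ≥0 → Ω → GaugeConfig 3 L (Matrix.specialUnitaryGroup (Fin 2) ℂ)),
        (∀ ω, U 0 ω = x) →
        (latticeLangevinDynamics (fundamentalLatticeRep 2) β').IsSolution (fundamentalRep (Fin 2))
          hW.natFiltration P W U →
        κ t x = P.map (U t))
    {ρ : ℝ} (hρ : 0 ≤ ρ)
    (hLSgen : ∀ (f : (Edge 3 L × Fin 2 × Fin 2 × Bool → ℝ) → ℝ), ContDiff ℝ 3 f →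
        let coords : GaugeConfig 3 L (Matrix.specialUnitaryGroup (Fin 2) ℂ) → (Edge 3 L × Fin 2 × Fin 2 × Bool → ℝ) :=
          fun V q => (fun z : ℂ => if q.2.2.2 then z.im else z.re)
            ((fundamentalRep (Fin 2) (V q.1) : Matrix (Fin 2) (Fin 2) ℂ) q.2.1 q.2.2.1)
        let gen : GaugeConfig 3 L (Matrix.specialUnitaryGroup (Fin 2) ℂ) → ℝ := fun V =>
          (∑ i : Edge 3 L × Fin 2 × Fin 2 × Bool, fderiv ℝ f (coords V) (Pi.single i 1) *
              (fun z : ℂ => if i.2.2.2 then z.im else z.re)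
                ((latticeLangevinDynamics (fundamentalLatticeRep 2) β').drift
                  (matrixConfig (fundamentalRep (Fin 2)) V) i.1 i.2.1 i.2.2.1) +
          1 / 2 * ∑ i : Edge 3 L × Fin 2 × Fin 2 × Bool, ∑ j : Edge 3 L × Fin 2 × Fin 2 × Bool,
            fderiv ℝ (fun z => fderiv ℝ f z (Pi.single i 1)) (coords V) (Pi.single j 1) *
              ∑ n : Edge 3 L × NoiseIdx 2,
                (if n.1 = i.1 then (fun z : ℂ => if i.2.2.2 then z.im else z.re)
                  ((latticeLangevinDynamics (fundamentalLatticeRep 2) β').noise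
                    (matrixConfig (fundamentalRep (Fin 2)) V) i.1 n.2 i.2.1 i.2.2.1) else 0) *
                (if n.1 = j.1 then (fun z : ℂ => if j.2.2.2 then z.im else z.re)
                  ((latticeLangevinDynamics (fundamentalLatticeRep 2) β').noise
                    (matrixConfig (fundamentalRep (Fin 2)) V) j.1 n.2 j.2.1 j.2.2.1) else 0))
        ρ * ((∫ V, f (coords V) ^ 2 * Real.log (f (coords V) ^ 2) ∂(wilsonMeasure (d := 3) (L := L) (fundamentalRep (Fin 2)) β')) -
            (∫ V, f (coords V) ^ 2 ∂(wilsonMeasure (d := 3) (L := L) (fundamentalRep (Fin 2)) β')) *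
              Real.log (∫ V, f (coords V) ^ 2 ∂(wilsonMeasure (d := 3) (L := L) (fundamentalRep (Fin 2)) β'))) ≤
          -∫ V, f (coords V) * gen V ∂(wilsonMeasure (d := 3) (L := L) (fundamentalRep (Fin 2)) β'))
    {G : GaugeConfig 3 L (Matrix.specialUnitaryGroup (Fin 2) ℂ) → ℝ} (hGm : Measurable G) {M : ℝ} (hGM : ∀ x, |G x| ≤ M)
    {p : ℝ} (hp : 1 < p) (t : ℝ≥0) :
    (∫ x, |∫ y, G y ∂(κ t x)| ^ (1 + (p - 1) * Real.exp (4 * ρ * t))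
        ∂(wilsonMeasure (d := 3) (L := L) (fundamentalRep (Fin 2)) β')) ^ (1 / (1 + (p - 1) * Real.exp (4 * ρ * t))) ≤
      (∫ x, |G x| ^ p ∂(wilsonMeasure (d := 3) (L := L) (fundamentalRep (Fin 2)) β')) ^ (1 / p) := by
  classical
  haveI := secondCountableTopology_su2
  haveI := borelSpace_config L
  set μ : Measure (GaugeConfig 3 L (Matrix.specialUnitaryGroup (Fin 2) ℂ)) :=
    wilsonMeasure (d := 3) (L := L) (fundamentalRep (Fin 2)) β' with hμ
  haveI : IsProbabilityMeasure μ :=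
    isProbabilityMeasure_wilsonMeasure (d := 3) (L := L) (fundamentalRep (Fin 2)) (continuous_fundamentalRep (Fin 2)) β'
  set q : ℝ := 1 + (p - 1) * Real.exp (4 * ρ * t) with hq
  have hq1 : 1 < q := by
    have : 0 < (p - 1) * Real.exp (4 * ρ * t) := mul_pos (by linarith) (Real.exp_pos _)
    rw [hq]; linarith
  have hq0 : 0 < q := by linarith
  have hp0 : 0 < p := by linarith
  -- `g = |G|`
  set g : GaugeConfig 3 L (Matrix.specialUnitaryGroup (Fin 2) ℂ) → ℝ := fun x => |G x| with hg
  have hgm : Measurable g := hGm.abs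
  have hg0 : ∀ x, 0 ≤ g x := fun x => abs_nonneg _
  have hgM : ∀ x, g x ≤ M := hGM
  have hM0 : 0 ≤ M := (hg0 (Classical.arbitrary _)).trans (hgM _)
  have hgb : ∀ x, |g x| ≤ M + 2 := fun x => by rw [abs_of_nonneg (hg0 x)]; linarith [hgM x]
  -- positive cylinders `F_n` with `∫ |F_n − g| ≤ 1/(n+1)`
  have happ := fun n : ℕ => exists_pos_cylinder_integral_abs_sub_le L β' hgm hg0 hgM
    (show (0 : ℝ) < 1 / ((n : ℝ) + 1) by positivity)
  choose f hf hfc hrest using happ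
  set Fs : ℕ → GaugeConfig 3 L (Matrix.specialUnitaryGroup (Fin 2) ℂ) → ℝ := fun n x =>
    f n (fun q => (fun z : ℂ => if q.2.2.2 then z.im else z.re)
      ((fundamentalRep (Fin 2) (x q.1) : Matrix (Fin 2) (Fin 2) ℂ) q.2.1 q.2.2.1)) with hFs
  have hFpos : ∀ n x, 0 < Fs n x := fun n => (hrest n).1
  have hFM : ∀ n x, Fs n x ≤ M + 2 := fun n => (hrest n).2.1
  have hFL1 : ∀ n, ∫ x, |Fs n x - g x| ∂μ ≤ 1 / ((n : ℝ) + 1) := fun n => (hrest n).2.2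
  have hFc : ∀ n, Continuous (Fs n) := fun n => (hf n).continuous.comp (continuous_coords (L := L))
  have hFb : ∀ n x, |Fs n x| ≤ M + 2 := fun n x => by rw [abs_of_pos (hFpos n x)]; exact hFM n x
  -- hypercontractivity for each `F_n`, in absolute-value form
  have hKFpos : ∀ n x, 0 < ∫ y, Fs n y ∂(κ t x) := by
    intro n x
    obtain ⟨δ, hδ, hδF⟩ := exists_pos_le_of_continuous_of_compactSpace (hFc n) (hFpos n)
    have h1 : δ ≤ ∫ y, Fs n y ∂(κ t x) := by
      have := integral_mono (integrable_const (μ := κ t x) δ) (integrable_of_continuous_of_compactSpace (hFc n) _)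
        fun y => hδF y
      rwa [integral_const, probReal_univ, one_smul] at this
    exact lt_of_lt_of_le hδ h1
  have hdec : ∀ n, (∫ x, |∫ y, Fs n y ∂(κ t x)| ^ q ∂μ) ^ (1 / q) ≤ (∫ x, |Fs n x| ^ p ∂μ) ^ (1 / p) := by
    intro n
    have h := lqNorm_transition_le_of_generatorLogSobolev L β' κ hreal hρ hLSgen (hf n) (hfc n) (hFpos n) hp t
    have e1 : ∫ x, |∫ y, Fs n y ∂(κ t x)| ^ q ∂μ = ∫ x, (∫ y, Fs n y ∂(κ t x)) ^ q ∂μ :=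
      integral_congr_ae (Eventually.of_forall fun x => by simp only [abs_of_pos (hKFpos n x)])
    have e2 : ∫ x, |Fs n x| ^ p ∂μ = ∫ x, (Fs n x) ^ p ∂μ :=
      integral_congr_ae (Eventually.of_forall fun x => by simp only [abs_of_pos (hFpos n x)])
    rw [e1, e2]
    exact h
  -- `L¹` convergence of `F_n → g` and of `κ_t F_n → κ_t g`
  have hL1 : Tendsto (fun n => ∫ x, |Fs n x - g x| ∂μ) atTop (𝓝 0) := by
    refine squeeze_zero (fun n => integral_nonneg fun x => abs_nonneg _) hFL1 ?_
    exact tendsto_one_div_add_atTop_nhds_zero_nat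
  have hKL1 : Tendsto (fun n => ∫ x, |(∫ y, Fs n y ∂(κ t x)) - ∫ y, g y ∂(κ t x)| ∂μ) atTop (𝓝 0) := by
    refine squeeze_zero (fun n => integral_nonneg fun x => abs_nonneg _) (fun n => ?_) hL1
    exact integral_abs_transition_sub_le L β' κ hreal t (hFc n).measurable hgm (hFb n) hgb
  -- measurability and bounds of `κ_t F_n`, `κ_t g`
  have hKgm : Measurable fun x => ∫ y, g y ∂(κ t x) := (hgm.stronglyMeasurable.integral_kernel (κ := κ t)).measurable
  have hKFc : ∀ n, Continuous fun x => ∫ y, Fs n y ∂(κ t x) := fun n =>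
    continuous_integral_transitionKernel L β' κ hreal t (hFc n)
  have hKFb : ∀ n x, |∫ y, Fs n y ∂(κ t x)| ≤ M + 2 := fun n x =>
    abs_integral_le_of_abs_le_of_isProbabilityMeasure (μ := κ t x) (hFb n)
  have hKgb : ∀ x, |∫ y, g y ∂(κ t x)| ≤ M + 2 := fun x =>
    abs_integral_le_of_abs_le_of_isProbabilityMeasure (μ := κ t x) hgb
  -- pass to the limit
  have hφq : Continuous fun x : ℝ => |x| ^ q := continuous_abs.rpow_const fun x => Or.inr hq0.le
  have hφp : Continuous fun x : ℝ => |x| ^ p := continuous_abs.rpow_const fun x => Or.inr hp0.le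
  have T1 := EntropyFlow.tendsto_integral_comp_of_tendsto_integral_abs_sub (ν := μ) (fun n => (hFc n).aestronglyMeasurable)
    hgm.aestronglyMeasurable hFb hgb hL1 hφp
  have T3 := EntropyFlow.tendsto_integral_comp_of_tendsto_integral_abs_sub (ν := μ) (fun n => (hKFc n).aestronglyMeasurable)
    hKgm.aestronglyMeasurable hKFb hKgb hKL1 hφq
  have hrq : Continuous fun y : ℝ => y ^ (1 / q) := Real.continuous_rpow_const (by positivity)
  have hrp : Continuous fun y : ℝ => y ^ (1 / p) := Real.continuous_rpow_const (by positivity)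
  have Tlhs := (hrq.tendsto _).comp T3
  have Trhs := (hrp.tendsto _).comp T1
  have hlim : (∫ x, |∫ y, g y ∂(κ t x)| ^ q ∂μ) ^ (1 / q) ≤ (∫ x, |g x| ^ p ∂μ) ^ (1 / p) :=
    le_of_tendsto_of_tendsto' Tlhs Trhs hdec
  -- `|κ_t G| ≤ κ_t |G|` and `|g| = |G|`
  have e3 : ∫ x, |g x| ^ p ∂μ = ∫ x, |G x| ^ p ∂μ :=
    integral_congr_ae (Eventually.of_forall fun x => by simp only [hg, abs_abs])
  have hGint : ∀ x, Integrable G (κ t x) := fun x =>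
    Integrable.of_bound hGm.aestronglyMeasurable M (ae_of_all _ fun y => by rw [Real.norm_eq_abs]; exact hGM y)
  have hpt : ∀ x, |∫ y, G y ∂(κ t x)| ^ q ≤ |∫ y, g y ∂(κ t x)| ^ q := by
    intro x
    have h1 : |∫ y, G y ∂(κ t x)| ≤ ∫ y, g y ∂(κ t x) := abs_integral_le_integral_abs
    have h2 : (∫ y, g y ∂(κ t x)) ≤ |∫ y, g y ∂(κ t x)| := le_abs_self _
    exact Real.rpow_le_rpow (abs_nonneg _) (h1.trans h2) hq0.le
  have hKGm : Measurable fun x => ∫ y, G y ∂(κ t x) := (hGm.stronglyMeasurable.integral_kernel (κ := κ t)).measurable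
  have hKGb : ∀ x, |∫ y, G y ∂(κ t x)| ≤ M := fun x => abs_integral_le_of_abs_le_of_isProbabilityMeasure (μ := κ t x) hGM
  have iG : Integrable (fun x => |∫ y, G y ∂(κ t x)| ^ q) μ := by
    refine Integrable.of_bound ((hφq.measurable.comp hKGm).aestronglyMeasurable) (M ^ q) (ae_of_all _ fun x => ?_)
    rw [Real.norm_eq_abs, abs_of_nonneg (Real.rpow_nonneg (abs_nonneg _) q)]
    exact Real.rpow_le_rpow (abs_nonneg _) (hKGb x) hq0.le
  have ig : Integrable (fun x => |∫ y, g y ∂(κ t x)| ^ q) μ := by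
    refine Integrable.of_bound ((hφq.measurable.comp hKgm).aestronglyMeasurable) ((M + 2) ^ q) (ae_of_all _ fun x => ?_)
    rw [Real.norm_eq_abs, abs_of_nonneg (Real.rpow_nonneg (abs_nonneg _) q)]
    exact Real.rpow_le_rpow (abs_nonneg _) (hKgb x) hq0.le
  have hmono : ∫ x, |∫ y, G y ∂(κ t x)| ^ q ∂μ ≤ ∫ x, |∫ y, g y ∂(κ t x)| ^ q ∂μ := integral_mono iG ig hpt
  have hstep : (∫ x, |∫ y, G y ∂(κ t x)| ^ q ∂μ) ^ (1 / q) ≤ (∫ x, |∫ y, g y ∂(κ t x)| ^ q ∂μ) ^ (1 / q) :=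
    Real.rpow_le_rpow (integral_nonneg fun x => Real.rpow_nonneg (abs_nonneg _) q) hmono (by positivity)
  rw [← e3]
  exact hstep.trans hlim

/-! ## §2. Explicit constants -/

/-- ★★★ **Hypercontractivity of the SZZ semigroup at every fixed cut-off, UNCONDITIONALLY.**  For every `L`, `β'`, every
realising kernel family, every bounded measurable `G`, every `1 < p` and `t ≥ 0`:

  `(∫ |κ_t G|^{q} dμ_{β'})^{1/q} ≤ (∫ |G|^p dμ_{β'})^{1/p}`,   `q = 1 + (p − 1)·exp(4ρt)`,   `ρ = ½e^{−|β'|·4·#𝒫}`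

(Gross's theorem with the log-Sobolev hypothesis DISCHARGED by the Holley–Stroock constant `wilson_generatorLogSobolev_explicit`).
HONEST FRAMING: `ρ` degenerates like `e^{−12|β'|L³}`; no cut-off-uniform content. [cite: DiaconisSaloffcoste1996, Theorem 3.5 (ii)] -/
theorem wilson_hypercontractivity_explicit (L : ℕ) [NeZero L] (β' : ℝ)
    (κ : ℝ≥0 → Kernel (GaugeConfig 3 L (Matrix.specialUnitaryGroup (Fin 2) ℂ))
      (GaugeConfig 3 L (Matrix.specialUnitaryGroup (Fin 2) ℂ))) [∀ t, IsMarkovKernel (κ t)]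
    (hreal : ∀ (t : ℝ≥0) (x : GaugeConfig 3 L (Matrix.specialUnitaryGroup (Fin 2) ℂ))
        (Ω : Type) [MeasurableSpace Ω] (P : Measure Ω) [IsProbabilityMeasure P]
        (W : ℝ≥0 → Ω → (Edge 3 L × NoiseIdx 2 → ℝ)) (hW : IsFlatBrownian W P)
        (U : ℝ≥0 → Ω → GaugeConfig 3 L (Matrix.specialUnitaryGroup (Fin 2) ℂ)),
        (∀ ω, U 0 ω = x) →
        (latticeLangevinDynamics (fundamentalLatticeRep 2) β').IsSolution (fundamentalRep (Fin 2))
          hW.natFiltration P W U →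
        κ t x = P.map (U t))
    {G : GaugeConfig 3 L (Matrix.specialUnitaryGroup (Fin 2) ℂ) → ℝ} (hGm : Measurable G) {M : ℝ} (hGM : ∀ x, |G x| ≤ M)
    {p : ℝ} (hp : 1 < p) (t : ℝ≥0) :
    (∫ x, |∫ y, G y ∂(κ t x)| ^ (1 + (p - 1) * Real.exp (4 * ((1 / 2 : ℝ) *
        Real.exp (-(|β'| * (4 * (Fintype.card (Plaquette 3 L) : ℝ))))) * t))
        ∂(wilsonMeasure (d := 3) (L := L) (fundamentalRep (Fin 2)) β')) ^
        (1 / (1 + (p - 1) * Real.exp (4 * ((1 / 2 : ℝ) * Real.exp (-(|β'| * (4 * (Fintype.card (Plaquette 3 L) : ℝ))))) * t))) ≤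
      (∫ x, |G x| ^ p ∂(wilsonMeasure (d := 3) (L := L) (fundamentalRep (Fin 2)) β')) ^ (1 / p) :=
  lqNorm_transition_le_of_generatorLogSobolev_of_measurable L β' κ hreal
    (ρ := (1 / 2 : ℝ) * Real.exp (-(|β'| * (4 * (Fintype.card (Plaquette 3 L) : ℝ))))) (by positivity)
    (fun h hh => wilson_generatorLogSobolev_explicit L β' h hh) hGm hGM hp t

/-- ★★★ **Volume-uniform hypercontractivity of the SZZ semigroup at small `|β'|`.**  For every `L`, every `|β'| < 1/12`, every
realising kernel family, every bounded measurable `G`, every `1 < p` and `t ≥ 0`: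

  `(∫ |κ_t G|^{q} dμ_{β'})^{1/q} ≤ (∫ |G|^p dμ_{β'})^{1/p}`,   `q = 1 + (p − 1)·exp(2(1 − 12|β'|)t)`,

with the `L`-INDEPENDENT log-Sobolev constant `ρ = (1 − 12|β'|)/2` of `wilson_generatorLogSobolev_uniform` (Bakry–Émery; the `N = 2`,
`d = 3` instance of Shen–Zhu–Zhu's Cor. 4.4 regime).  HONEST FRAMING: high-temperature window only; the route's scaling `β'_K → ∞`
leaves it. [cite: ShenZhuZhu2022, Theorem 4.2 / Cor. 4.4] -/
theorem wilson_hypercontractivity_uniform (L : ℕ) [NeZero L] (β' : ℝ) (hβ : |β'| < 1 / 12)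
    (κ : ℝ≥0 → Kernel (GaugeConfig 3 L (Matrix.specialUnitaryGroup (Fin 2) ℂ))
      (GaugeConfig 3 L (Matrix.specialUnitaryGroup (Fin 2) ℂ))) [∀ t, IsMarkovKernel (κ t)]
    (hreal : ∀ (t : ℝ≥0) (x : GaugeConfig 3 L (Matrix.specialUnitaryGroup (Fin 2) ℂ))
        (Ω : Type) [MeasurableSpace Ω] (P : Measure Ω) [IsProbabilityMeasure P]
        (W : ℝ≥0 → Ω → (Edge 3 L × NoiseIdx 2 → ℝ)) (hW : IsFlatBrownian W P)
        (U : ℝ≥0 → Ω → GaugeConfig 3 L (Matrix.specialUnitaryGroup (Fin 2) ℂ)),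
        (∀ ω, U 0 ω = x) →
        (latticeLangevinDynamics (fundamentalLatticeRep 2) β').IsSolution (fundamentalRep (Fin 2))
          hW.natFiltration P W U →
        κ t x = P.map (U t))
    {G : GaugeConfig 3 L (Matrix.specialUnitaryGroup (Fin 2) ℂ) → ℝ} (hGm : Measurable G) {M : ℝ} (hGM : ∀ x, |G x| ≤ M)
    {p : ℝ} (hp : 1 < p) (t : ℝ≥0) :
    (∫ x, |∫ y, G y ∂(κ t x)| ^ (1 + (p - 1) * Real.exp (4 * ((1 - 12 * |β'|) / 2) * t))
        ∂(wilsonMeasure (d := 3) (L := L) (fundamentalRep (Fin 2)) β')) ^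
        (1 / (1 + (p - 1) * Real.exp (4 * ((1 - 12 * |β'|) / 2) * t))) ≤
      (∫ x, |G x| ^ p ∂(wilsonMeasure (d := 3) (L := L) (fundamentalRep (Fin 2)) β')) ^ (1 / p) :=
  lqNorm_transition_le_of_generatorLogSobolev_of_measurable L β' κ hreal (ρ := (1 - 12 * |β'|) / 2)
    (by linarith) (fun h hh => wilson_generatorLogSobolev_uniform L β' hβ h hh) hGm hGM hp t

/-- ★★ **Nelson's `2 → 4` time.**  For every `L`, `β'`, every realising kernel family and every bounded measurable `G`:
`‖κ_t G‖_{L⁴(μ_{β'})} ≤ ‖G‖_{L²(μ_{β'})}` at `t = log 3/(4ρ)`, `ρ = ½e^{−|β'|·4·#𝒫}` (`q(t) = 1 + e^{4ρt} = 4`).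
[cite: DiaconisSaloffcoste1996, Theorem 3.5 (ii)] -/
theorem wilson_two_to_four (L : ℕ) [NeZero L] (β' : ℝ)
    (κ : ℝ≥0 → Kernel (GaugeConfig 3 L (Matrix.specialUnitaryGroup (Fin 2) ℂ))
      (GaugeConfig 3 L (Matrix.specialUnitaryGroup (Fin 2) ℂ))) [∀ t, IsMarkovKernel (κ t)]
    (hreal : ∀ (t : ℝ≥0) (x : GaugeConfig 3 L (Matrix.specialUnitaryGroup (Fin 2) ℂ))
        (Ω : Type) [MeasurableSpace Ω] (P : Measure Ω) [IsProbabilityMeasure P]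
        (W : ℝ≥0 → Ω → (Edge 3 L × NoiseIdx 2 → ℝ)) (hW : IsFlatBrownian W P)
        (U : ℝ≥0 → Ω → GaugeConfig 3 L (Matrix.specialUnitaryGroup (Fin 2) ℂ)),
        (∀ ω, U 0 ω = x) →
        (latticeLangevinDynamics (fundamentalLatticeRep 2) β').IsSolution (fundamentalRep (Fin 2))
          hW.natFiltration P W U →
        κ t x = P.map (U t))
    {G : GaugeConfig 3 L (Matrix.specialUnitaryGroup (Fin 2) ℂ) → ℝ} (hGm : Measurable G) {M : ℝ} (hGM : ∀ x, |G x| ≤ M) :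
    (∫ x, |∫ y, G y ∂(κ (Real.log 3 / (4 * ((1 / 2 : ℝ) *
        Real.exp (-(|β'| * (4 * (Fintype.card (Plaquette 3 L) : ℝ))))))).toNNReal x)| ^ (4 : ℝ)
        ∂(wilsonMeasure (d := 3) (L := L) (fundamentalRep (Fin 2)) β')) ^ (1 / (4 : ℝ)) ≤
      (∫ x, |G x| ^ (2 : ℝ) ∂(wilsonMeasure (d := 3) (L := L) (fundamentalRep (Fin 2)) β')) ^ (1 / (2 : ℝ)) := by
  set ρ : ℝ := (1 / 2 : ℝ) * Real.exp (-(|β'| * (4 * (Fintype.card (Plaquette 3 L) : ℝ)))) with hρ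
  have hρpos : 0 < ρ := by rw [hρ]; positivity
  set t : ℝ≥0 := (Real.log 3 / (4 * ρ)).toNNReal with ht
  have hlog3 : 0 ≤ Real.log 3 := Real.log_nonneg (by norm_num)
  have htR : (t : ℝ) = Real.log 3 / (4 * ρ) := by rw [ht, Real.coe_toNNReal _ (by positivity)]
  have h := wilson_hypercontractivity_explicit L β' κ hreal hGm hGM (p := 2) (by norm_num) t
  have e : 1 + ((2 : ℝ) - 1) * Real.exp (4 * ρ * t) = 4 := by
    rw [htR]
    have : 4 * ρ * (Real.log 3 / (4 * ρ)) = Real.log 3 := by field_simp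
    rw [this, Real.exp_log (by norm_num)]
    norm_num
  simp only [← hρ] at h
  rw [e] at h
  exact h

end Summit.QuantumFields.YangMills.Theorems.ColdStartUniversality

end
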